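import Mathlib
import HarnessLib

/-!
# Peano kernels of the trapezoidal and midpoint rules; the midpoint rule error; bracketing
# (Davis–Rabinowitz Sect. 2.1 (2.1.3), (2.1.11)–(2.1.12) and Corollary; Sect. 4.3 (4.3.11)–(4.3.18))

**Statements.** For `f ∈ C²[a, b]` the truncation errors of the one-panel trapezoidal and midpoint
rules are integrals of `f''` against explicit one-signed PEANO KERNELS (Davis–Rabinowitz, *Methods of Numerical
Integration*, 2nd ed., Sect. 4.3, Peano's theorem (4.3.5)–(4.3.6) with `n = 1`):

* (4.3.16) `∫_a^b f - (b - a)/2 · (f a + f b) = ½ ∫_a^b (a - t)(b - t) f''(t) dt`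
  (`integral_sub_trapezoid_eq_integral_kernel`; in Mathlib's notation `trapezoidal_error f 1 a b =
  ½ ∫ (t - a)(b - t) f''`), whence by the mean-value theorem for integrals (4.3.13) the classical form
  (4.3.18) = (2.1.11) with one panel, `∫ f = (b - a)/2 (f a + f b) - (b - a)³/12 · f''(ξ)`;
* the midpoint analogue `∫_a^b f - (b - a) f((a + b)/2) = ∫_a^b K_M f''`, `K_M(t) = (t - a)²/2` left of the
  midpoint and `(b - t)²/2` right of it, `∫ K_M = (b - a)³/24` (`integral_sub_midpoint_eq_integral_kernel`), whence
  (2.1.12) with one panel `∫ f - (b - a) f((a+b)/2) = (b - a)³/24 · f''(ξ)` and the bound `|…| ≤ ζ (b - a)³/24` for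
  `|f''| ≤ ζ` ((4.3.11));
* the compound midpoint rule `M_n(f) = h Σ_{k<n} f(a + (k + ½) h)`, `h = (b - a)/n` ((2.1.3), `midpointRule`) and
  its error bound `|∫_a^b f - M_n(f)| ≤ ζ (b - a)³ / (24 n²)` ((2.1.12); `abs_integral_sub_midpointRule_le`);
* the BRACKETING PROPERTY (Corollary after (2.1.12), p. 52): if `f'' ≥ 0` on `[a, b]` then
  `M_n(f) ≤ ∫_a^b f ≤ T_n(f)` (`midpointRule_le_integral`, `integral_le_trapezoidal_integral`, the latter for
  Mathlib's `trapezoidal_integral`).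

The weighted mean-value theorem for integrals used in (4.3.13) is proved as
`exists_integral_mul_eq_mul_integral` (continuous `g`, weight `w ≥ 0`).

**Hypotheses.** As in Mathlib's integration-by-parts API the derivatives are explicit functions:
`HasDerivAt f (f' x) x` and `HasDerivAt f' (f'' x) x` on `[[a, b]]`, `f''` interval integrable (continuous on
`[a, b]` for the `ξ`-forms).  The proofs ARE two integrations by parts per half-panel
(`intervalIntegral.integral_mul_deriv_eq_deriv_mul`), i.e. the `n = 1` case of the proof of Peano's theorem.

**Prior art.** Mathlib has the compound trapezoidal rule and its error BOUND
(`trapezoidal_integral`, `trapezoidal_error_le`: `|T_N - ∫ f| ≤ |b - a|³ ζ / (12 N²)`); it has neither the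
kernel identities, nor the `ξ`-forms, nor the midpoint rule, nor bracketing.  The tree's
`Literature.Analysis.Quadrature.TrapezoidalRulePeriodic` / `…RealLine` are the exponentially convergent
(analytic, periodic / whole-line) estimates of Trefethen–Weideman, a different regime.

**Engine use.** Two-sided MONOTONE ENCLOSURES `M_n(f) ≤ ∫ f ≤ T_n(f)` for convex integrands are the cheapest
certified brackets a client cell can ask for (no derivative bounds needed beyond the sign of `f''`), and the
`ζ (b - a)³/(24 n²)` bound is the a-priori panel count for a requested tolerance (cf. Marsden–Weinstein Example 6,
Sect. 11.5).  Honest framing: shared numerical engines serving client cells; rigour lives in the verifiers; every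
published number belongs to a client cell's ledger, not to the engines group.

References: [DavisRabinowitz1984] P. J. Davis, P. Rabinowitz, *Methods of Numerical Integration*, 2nd ed.,
Academic Press 1984, Sect. 2.1 (pp. 51–53), Sect. 4.3 (pp. 285–288); [MarsdenWeinstein1985] J. Marsden,
A. Weinstein, *Calculus II*, Springer 1985, Sect. 11.5 (pp. 551–554).
-/

namespace Literature.Analysis.Quadrature

open Set MeasureTheory intervalIntegral Finset
open scoped Real Interval

noncomputable section

/-! ### The weighted mean-value theorem for integrals -/

/-- **Mean-value theorem for integrals with a non-negative weight** (the step (4.3.13) of op. cit.): for `a ≤ b`,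
`g` continuous on `[a, b]`, `w ≥ 0` on `[a, b]` with `w` and `w · g` interval integrable, there is `ξ ∈ [a, b]`
with `∫_a^b w g = g(ξ) ∫_a^b w`. [cite: DavisRabinowitz1984, Sect. 4.3 (4.3.13)] -/
theorem exists_integral_mul_eq_mul_integral {w g : ℝ → ℝ} {a b : ℝ} (hab : a ≤ b)
    (hg : ContinuousOn g (Icc a b)) (hw : ∀ x ∈ Icc a b, 0 ≤ w x) (hwi : IntervalIntegrable w volume a b)
    (hwgi : IntervalIntegrable (fun x => w x * g x) volume a b) :
    ∃ ξ ∈ Icc a b, ∫ x in a..b, w x * g x = g ξ * ∫ x in a..b, w x := by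
  have hne : (Icc a b).Nonempty := nonempty_Icc.mpr hab
  obtain ⟨x₁, hx₁, hmin⟩ := isCompact_Icc.exists_isMinOn hne hg
  obtain ⟨x₂, hx₂, hmax⟩ := isCompact_Icc.exists_isMaxOn hne hg
  have hlo : g x₁ * ∫ x in a..b, w x ≤ ∫ x in a..b, w x * g x := by
    rw [← intervalIntegral.integral_const_mul]
    refine intervalIntegral.integral_mono_on hab (hwi.const_mul _) hwgi fun x hx => ?_
    rw [mul_comm]
    exact mul_le_mul_of_nonneg_left (hmin hx) (hw x hx)
  have hhi : ∫ x in a..b, w x * g x ≤ g x₂ * ∫ x in a..b, w x := by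
    rw [← intervalIntegral.integral_const_mul]
    refine intervalIntegral.integral_mono_on hab hwgi (hwi.const_mul _) fun x hx => ?_
    rw [mul_comm (g x₂)]
    exact mul_le_mul_of_nonneg_left (hmax hx) (hw x hx)
  have hW : 0 ≤ ∫ x in a..b, w x := intervalIntegral.integral_nonneg hab hw
  rcases hW.eq_or_lt with hW0 | hWpos
  · refine ⟨x₁, hx₁, ?_⟩
    rw [← hW0, mul_zero] at hlo hhi ⊢
    exact le_antisymm hhi hlo
  · -- the ratio lies between the extreme values of `g`; intermediate value theorem on `[[x₁, x₂]] ⊆ [a, b]`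
    set r := (∫ x in a..b, w x * g x) / ∫ x in a..b, w x with hr
    have hr1 : g x₁ ≤ r := by rw [hr, le_div_iff₀ hWpos]; exact hlo
    have hr2 : r ≤ g x₂ := by rw [hr, div_le_iff₀ hWpos]; exact hhi
    have hsub : [[x₁, x₂]] ⊆ Icc a b := uIcc_subset_Icc hx₁ hx₂
    have hivt := intermediate_value_uIcc (hg.mono hsub)
    obtain ⟨ξ, hξ, hgξ⟩ := hivt (show r ∈ [[g x₁, g x₂]] from by
      rw [uIcc_of_le (hr1.trans hr2)]; exact ⟨hr1, hr2⟩)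
    refine ⟨ξ, hsub hξ, ?_⟩
    rw [hgξ, hr, div_mul_cancel₀ _ hWpos.ne']

/-! ### The trapezoidal rule: Peano kernel (4.3.16) and the `ξ`-form (4.3.18) -/

/-- **Peano kernel of the trapezoidal rule** (Davis–Rabinowitz (4.3.16)): if `f` has a derivative `f'` and `f'` a
derivative `f''` on `[[a, b]]` with `f''` interval integrable, then
`∫_a^b f - (b - a)/2 · (f a + f b) = ½ ∫_a^b (a - t)(b - t) f''(t) dt` (two integrations by parts).
[cite: DavisRabinowitz1984, Sect. 4.3 (4.3.16)] -/
theorem integral_sub_trapezoid_eq_integral_kernel {f f' f'' : ℝ → ℝ} {a b : ℝ}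
    (hf : ∀ x ∈ [[a, b]], HasDerivAt f (f' x) x) (hf' : ∀ x ∈ [[a, b]], HasDerivAt f' (f'' x) x)
    (hf'' : IntervalIntegrable f'' volume a b) :
    (∫ x in a..b, f x) - (b - a) / 2 * (f a + f b) = 2⁻¹ * ∫ x in a..b, (a - x) * (b - x) * f'' x := by
  set K : ℝ → ℝ := fun x => (a - x) * (b - x) / 2 with hKdef
  set K' : ℝ → ℝ := fun x => x - (a + b) / 2 with hK'def
  have hK : ∀ x, HasDerivAt K (K' x) x := by
    intro x
    have h1 : HasDerivAt (fun x => (a - x) * (b - x) / 2) ((-1 * (b - x) + (a - x) * -1) / 2) x :=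
      (((hasDerivAt_id x).const_sub a).mul ((hasDerivAt_id x).const_sub b)).div_const 2
    convert h1 using 1
    simp only [hK'def]
    ring
  have hK' : ∀ x, HasDerivAt K' 1 x := fun x => (hasDerivAt_id x).sub_const _
  have hfc : IntervalIntegrable f volume a b :=
    ContinuousOn.intervalIntegrable fun x hx => (hf x hx).continuousAt.continuousWithinAt
  have hf'c : IntervalIntegrable f' volume a b :=
    ContinuousOn.intervalIntegrable fun x hx => (hf' x hx).continuousAt.continuousWithinAt
  have hK'i : IntervalIntegrable K' volume a b := (continuous_id.sub continuous_const).intervalIntegrable _ _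
  have h1 := intervalIntegral.integral_mul_deriv_eq_deriv_mul (fun x _ => hK x) hf' hK'i hf''
  have h2 := intervalIntegral.integral_mul_deriv_eq_deriv_mul (fun x _ => hK' x) hf intervalIntegrable_const hf'c
  have h3 : 2⁻¹ * ∫ x in a..b, (a - x) * (b - x) * f'' x = ∫ x in a..b, K x * f'' x := by
    rw [← intervalIntegral.integral_const_mul]
    refine intervalIntegral.integral_congr fun x _ => ?_
    simp only [hKdef]
    ring
  rw [h3, h1, h2]
  simp only [hKdef, hK'def, sub_self, zero_mul, mul_zero, zero_div, one_mul, zero_sub]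
  ring

/-- The same identity for Mathlib's `trapezoidal_error f 1 a b = T₁(f) - ∫ f`:
`T₁(f) - ∫_a^b f = ½ ∫_a^b (t - a)(b - t) f''(t) dt`. [cite: DavisRabinowitz1984, Sect. 4.3 (4.3.16)] -/
theorem trapezoidal_error_one_eq_integral_kernel {f f' f'' : ℝ → ℝ} {a b : ℝ}
    (hf : ∀ x ∈ [[a, b]], HasDerivAt f (f' x) x) (hf' : ∀ x ∈ [[a, b]], HasDerivAt f' (f'' x) x)
    (hf'' : IntervalIntegrable f'' volume a b) :
    trapezoidal_error f 1 a b = 2⁻¹ * ∫ x in a..b, (x - a) * (b - x) * f'' x := by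
  have h := integral_sub_trapezoid_eq_integral_kernel hf hf' hf''
  rw [trapezoidal_error, trapezoidal_integral_one]
  have h2 : ∫ x in a..b, (x - a) * (b - x) * f'' x = -∫ x in a..b, (a - x) * (b - x) * f'' x := by
    rw [← intervalIntegral.integral_neg]
    refine intervalIntegral.integral_congr fun x _ => ?_
    ring
  rw [h2]
  linarith

/-- The integral of the (negative of the) trapezoidal kernel: `∫_a^b (t - a)(b - t) dt = (b - a)³/6`
(equivalently `E(x²) = -(b - a)³/6`, (4.3.17)). [cite: DavisRabinowitz1984, Sect. 4.3 (4.3.17)] -/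
theorem integral_trapezoidKernel (a b : ℝ) : ∫ x in a..b, (x - a) * (b - x) = (b - a) ^ 3 / 6 := by
  have h : (fun x : ℝ => (x - a) * (b - x)) = fun x => -(x ^ 2) + (a + b) * x - a * b := by
    funext x; ring
  rw [h, intervalIntegral.integral_sub, intervalIntegral.integral_add, intervalIntegral.integral_neg, integral_pow,
    intervalIntegral.integral_const_mul, integral_id, intervalIntegral.integral_const]
  · simp only [smul_eq_mul]
    ring
  all_goals apply Continuous.intervalIntegrable; fun_prop

/-- **The trapezoidal rule with its error term** (Davis–Rabinowitz (4.3.18); (2.1.11) with one panel; the source of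
Marsden–Weinstein's bound p. 552): for `a ≤ b` and `f ∈ C²[a, b]` (derivatives `f'`, `f''` on `[a, b]`, `f''`
continuous) there is `ξ ∈ [a, b]` with `∫_a^b f = (b - a)/2 (f a + f b) - (b - a)³/12 · f''(ξ)`.
[cite: DavisRabinowitz1984, Sect. 4.3 (4.3.18)] [cite: DavisRabinowitz1984, Sect. 2.1 (2.1.11)] -/
theorem integral_eq_trapezoid_sub_deriv2 {f f' f'' : ℝ → ℝ} {a b : ℝ} (hab : a ≤ b)
    (hf : ∀ x ∈ Icc a b, HasDerivAt f (f' x) x) (hf' : ∀ x ∈ Icc a b, HasDerivAt f' (f'' x) x)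
    (hf'' : ContinuousOn f'' (Icc a b)) :
    ∃ ξ ∈ Icc a b, ∫ x in a..b, f x = (b - a) / 2 * (f a + f b) - (b - a) ^ 3 / 12 * f'' ξ := by
  have hI : [[a, b]] = Icc a b := uIcc_of_le hab
  have hf''u : ContinuousOn f'' [[a, b]] := by rwa [hI]
  have hker := integral_sub_trapezoid_eq_integral_kernel (f := f) (fun x hx => hf x (hI ▸ hx))
    (fun x hx => hf' x (hI ▸ hx)) hf''u.intervalIntegrable
  have hwc : Continuous fun x : ℝ => (x - a) * (b - x) := by fun_prop
  have hwgi : IntervalIntegrable (fun x => (x - a) * (b - x) * f'' x) volume a b :=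
    (hwc.continuousOn.mul hf''u).intervalIntegrable
  obtain ⟨ξ, hξ, hmvt⟩ := exists_integral_mul_eq_mul_integral hab hf''
    (fun x hx => mul_nonneg (sub_nonneg.2 hx.1) (sub_nonneg.2 hx.2)) (hwc.intervalIntegrable _ _) hwgi
  refine ⟨ξ, hξ, ?_⟩
  have h2 : ∫ x in a..b, (a - x) * (b - x) * f'' x = -∫ x in a..b, (x - a) * (b - x) * f'' x := by
    rw [← intervalIntegral.integral_neg]
    refine intervalIntegral.integral_congr fun x _ => ?_
    ring
  rw [h2, hmvt, integral_trapezoidKernel] at hker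
  linarith

/-! ### The midpoint rule: Peano kernel, (2.1.12) with one panel, the error bound -/

/-- The Peano kernel of the one-panel midpoint rule: `K_M(t) = (t - a)²/2` for `t ≤ (a + b)/2` and `(b - t)²/2`
for `t ≥ (a + b)/2`, written as `min((t - a)², (b - t)²)/2` (the two descriptions agree on `[a, b]`;
Peano's theorem (4.3.5)–(4.3.6) with `n = 1` for `E(f) = ∫ f - (b - a) f((a+b)/2)`).
[cite: DavisRabinowitz1984, Sect. 4.3 (4.3.6)] -/
def midpointKernel (a b t : ℝ) : ℝ := min ((t - a) ^ 2) ((b - t) ^ 2) / 2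

/-- The midpoint kernel is non-negative. [cite: DavisRabinowitz1984, Sect. 4.3 (4.3.6)] -/
theorem midpointKernel_nonneg (a b t : ℝ) : 0 ≤ midpointKernel a b t := by
  unfold midpointKernel
  positivity

/-- The midpoint kernel is continuous. [cite: DavisRabinowitz1984, Sect. 4.3 (4.3.6)] -/
theorem continuous_midpointKernel (a b : ℝ) : Continuous (midpointKernel a b) := by
  unfold midpointKernel
  fun_prop

/-- Left of the midpoint the kernel is `(t - a)²/2`. [cite: DavisRabinowitz1984, Sect. 4.3 (4.3.6)] -/
theorem midpointKernel_of_le {a b t : ℝ} (hat : a ≤ t) (ht : t ≤ (a + b) / 2) :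
    midpointKernel a b t = (t - a) ^ 2 / 2 := by
  unfold midpointKernel
  rw [min_eq_left (pow_le_pow_left₀ (sub_nonneg.2 hat) (by linarith) 2)]

/-- Right of the midpoint the kernel is `(b - t)²/2`. [cite: DavisRabinowitz1984, Sect. 4.3 (4.3.6)] -/
theorem midpointKernel_of_ge {a b t : ℝ} (ht : (a + b) / 2 ≤ t) (htb : t ≤ b) :
    midpointKernel a b t = (b - t) ^ 2 / 2 := by
  unfold midpointKernel
  rw [min_eq_right (pow_le_pow_left₀ (sub_nonneg.2 htb) (by linarith) 2)]

/-- **Peano kernel of the midpoint rule**: for `a ≤ b` and `f` with derivatives `f'`, `f''` on `[a, b]`, `f''`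
interval integrable, `∫_a^b f - (b - a) f((a + b)/2) = ∫_a^b K_M(t) f''(t) dt` (two integrations by parts on
each half-panel; the `f'((a+b)/2)` boundary terms cancel). [cite: DavisRabinowitz1984, Sect. 4.3 (4.3.5)]
[cite: DavisRabinowitz1984, Sect. 2.1 (2.1.12)] -/
theorem integral_sub_midpoint_eq_integral_kernel {f f' f'' : ℝ → ℝ} {a b : ℝ} (hab : a ≤ b)
    (hf : ∀ x ∈ Icc a b, HasDerivAt f (f' x) x) (hf' : ∀ x ∈ Icc a b, HasDerivAt f' (f'' x) x)
    (hf'' : IntervalIntegrable f'' volume a b) :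
    (∫ x in a..b, f x) - (b - a) * f ((a + b) / 2) = ∫ x in a..b, midpointKernel a b x * f'' x := by
  set m : ℝ := (a + b) / 2 with hm
  have ham : a ≤ m := by rw [hm]; linarith
  have hmb : m ≤ b := by rw [hm]; linarith
  have hIab : [[a, b]] = Icc a b := uIcc_of_le hab
  have hIam : [[a, m]] ⊆ Icc a b := by rw [uIcc_of_le ham]; exact Icc_subset_Icc_right hmb
  have hImb : [[m, b]] ⊆ Icc a b := by rw [uIcc_of_le hmb]; exact Icc_subset_Icc_left ham
  have hIam' : [[a, m]] ⊆ [[a, b]] := by rw [hIab]; exact hIam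
  have hImb' : [[m, b]] ⊆ [[a, b]] := by rw [hIab]; exact hImb
  have hf''am : IntervalIntegrable f'' volume a m := hf''.mono_set hIam'
  have hf''mb : IntervalIntegrable f'' volume m b := hf''.mono_set hImb'
  have hfc : ContinuousOn f (Icc a b) := fun x hx => (hf x hx).continuousAt.continuousWithinAt
  have hf'c : ContinuousOn f' (Icc a b) := fun x hx => (hf' x hx).continuousAt.continuousWithinAt
  -- left half-panel: `u = (x - a)²/2`, then `u = x - a`
  have hL1 := intervalIntegral.integral_mul_deriv_eq_deriv_mul (a := a) (b := m)
    (u := fun x => (x - a) ^ 2 / 2) (u' := fun x => x - a) (v := f') (v' := f'')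
    (fun x _ => by simpa using (((hasDerivAt_id x).sub_const a).pow 2).div_const 2)
    (fun x hx => hf' x (hIam hx)) ((continuous_id.sub continuous_const).intervalIntegrable _ _) hf''am
  have hL2 := intervalIntegral.integral_mul_deriv_eq_deriv_mul (a := a) (b := m)
    (u := fun x => x - a) (u' := fun _ => (1 : ℝ)) (v := f) (v' := f')
    (fun x _ => (hasDerivAt_id x).sub_const a)
    (fun x hx => hf x (hIam hx)) intervalIntegrable_const (hf'c.mono hIam).intervalIntegrable
  -- right half-panel: `u = (x - b)²/2 = (b - x)²/2`, then `u = x - b`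
  have hR1 := intervalIntegral.integral_mul_deriv_eq_deriv_mul (a := m) (b := b)
    (u := fun x => (x - b) ^ 2 / 2) (u' := fun x => x - b) (v := f') (v' := f'')
    (fun x _ => by simpa using (((hasDerivAt_id x).sub_const b).pow 2).div_const 2)
    (fun x hx => hf' x (hImb hx)) ((continuous_id.sub continuous_const).intervalIntegrable _ _) hf''mb
  have hR2 := intervalIntegral.integral_mul_deriv_eq_deriv_mul (a := m) (b := b)
    (u := fun x => x - b) (u' := fun _ => (1 : ℝ)) (v := f) (v' := f')
    (fun x _ => (hasDerivAt_id x).sub_const b)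
    (fun x hx => hf x (hImb hx)) intervalIntegrable_const (hf'c.mono hImb).intervalIntegrable
  -- split `∫ f` and `∫ K_M f''` at the midpoint
  have hfi : IntervalIntegrable f volume a b := (hfc.mono hIab.le).intervalIntegrable
  have hsplitf : ∫ x in a..b, f x = (∫ x in a..m, f x) + ∫ x in m..b, f x :=
    (intervalIntegral.integral_add_adjacent_intervals (hfi.mono_set hIam') (hfi.mono_set hImb')).symm
  have hKi : IntervalIntegrable (fun x => midpointKernel a b x * f'' x) volume a b :=
    hf''.continuousOn_mul (continuous_midpointKernel a b).continuousOn
  have hsplitK : ∫ x in a..b, midpointKernel a b x * f'' x =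
      (∫ x in a..m, (x - a) ^ 2 / 2 * f'' x) + ∫ x in m..b, (x - b) ^ 2 / 2 * f'' x := by
    rw [← intervalIntegral.integral_add_adjacent_intervals (hKi.mono_set hIam') (hKi.mono_set hImb')]
    congr 1
    · refine intervalIntegral.integral_congr fun x hx => ?_
      rw [uIcc_of_le ham] at hx
      simp only [midpointKernel_of_le hx.1 hx.2]
    · refine intervalIntegral.integral_congr fun x hx => ?_
      rw [uIcc_of_le hmb] at hx
      simp only [midpointKernel_of_ge hx.1 hx.2]
      ring
  rw [hsplitK, hL1, hL2, hR1, hR2, hsplitf]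
  simp only [one_mul, sub_self, zero_mul, sub_zero]
  rw [hm]
  ring

/-- The integral of the midpoint kernel: `∫_a^b K_M = (b - a)³/24` (equivalently `E(x²) = (b - a)³/12`,
the case `f = x²/2` of the kernel identity). [cite: DavisRabinowitz1984, Sect. 2.1 (2.1.12)] -/
theorem integral_midpointKernel {a b : ℝ} (hab : a ≤ b) :
    ∫ x in a..b, midpointKernel a b x = (b - a) ^ 3 / 24 := by
  have h := integral_sub_midpoint_eq_integral_kernel hab (f := fun x => x ^ 2 / 2) (f' := fun x => x)
    (f'' := fun _ => 1)
    (fun x _ => by simpa using ((hasDerivAt_id x).pow 2).div_const 2)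
    (fun x _ => hasDerivAt_id x) intervalIntegrable_const
  simp only [mul_one] at h
  rw [← h, intervalIntegral.integral_div, integral_pow]
  ring

/-- **The midpoint rule with its error term** ((2.1.12) with one panel): for `a ≤ b` and `f ∈ C²[a, b]` there is
`ξ ∈ [a, b]` with `∫_a^b f = (b - a) f((a + b)/2) + (b - a)³/24 · f''(ξ)`.
[cite: DavisRabinowitz1984, Sect. 2.1 (2.1.12)] [cite: DavisRabinowitz1984, Sect. 4.3 (4.3.12)] -/
theorem integral_eq_midpoint_add_deriv2 {f f' f'' : ℝ → ℝ} {a b : ℝ} (hab : a ≤ b)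
    (hf : ∀ x ∈ Icc a b, HasDerivAt f (f' x) x) (hf' : ∀ x ∈ Icc a b, HasDerivAt f' (f'' x) x)
    (hf'' : ContinuousOn f'' (Icc a b)) :
    ∃ ξ ∈ Icc a b, ∫ x in a..b, f x = (b - a) * f ((a + b) / 2) + (b - a) ^ 3 / 24 * f'' ξ := by
  have hI : [[a, b]] = Icc a b := uIcc_of_le hab
  have hf''u : ContinuousOn f'' [[a, b]] := by rwa [hI]
  have hker := integral_sub_midpoint_eq_integral_kernel hab hf hf' hf''u.intervalIntegrable
  have hKc := continuous_midpointKernel a b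
  obtain ⟨ξ, hξ, hmvt⟩ := exists_integral_mul_eq_mul_integral hab hf'' (fun x _ => midpointKernel_nonneg a b x)
    (hKc.intervalIntegrable _ _) ((hKc.continuousOn.mul hf''u).intervalIntegrable)
  refine ⟨ξ, hξ, ?_⟩
  rw [hmvt, integral_midpointKernel hab] at hker
  linarith

/-- **Error bound for the one-panel midpoint rule** ((4.3.11) for the midpoint functional): if `|f''| ≤ ζ` on
`[a, b]` then `|∫_a^b f - (b - a) f((a + b)/2)| ≤ ζ (b - a)³/24`. [cite: DavisRabinowitz1984, Sect. 4.3 (4.3.11)]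
[cite: DavisRabinowitz1984, Sect. 2.1 (2.1.12)] -/
theorem abs_integral_sub_midpoint_le {f f' f'' : ℝ → ℝ} {a b : ℝ} (hab : a ≤ b)
    (hf : ∀ x ∈ Icc a b, HasDerivAt f (f' x) x) (hf' : ∀ x ∈ Icc a b, HasDerivAt f' (f'' x) x)
    (hf'' : IntervalIntegrable f'' volume a b) {ζ : ℝ} (hζ : ∀ x ∈ Icc a b, |f'' x| ≤ ζ) :
    |(∫ x in a..b, f x) - (b - a) * f ((a + b) / 2)| ≤ ζ * (b - a) ^ 3 / 24 := by
  rw [integral_sub_midpoint_eq_integral_kernel hab hf hf' hf'']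
  have hKc := continuous_midpointKernel a b
  have hKi : IntervalIntegrable (fun x => midpointKernel a b x * f'' x) volume a b :=
    hf''.continuousOn_mul hKc.continuousOn
  have hKζ : IntervalIntegrable (fun x => ζ * midpointKernel a b x) volume a b :=
    (hKc.intervalIntegrable _ _).const_mul ζ
  have hup : ∫ x in a..b, midpointKernel a b x * f'' x ≤ ∫ x in a..b, ζ * midpointKernel a b x := by
    refine intervalIntegral.integral_mono_on hab hKi hKζ fun x hx => ?_
    have := mul_le_mul_of_nonneg_left (le_of_abs_le (hζ x hx)) (midpointKernel_nonneg a b x)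
    linarith
  have hlo : ∫ x in a..b, -(ζ * midpointKernel a b x) ≤ ∫ x in a..b, midpointKernel a b x * f'' x := by
    refine intervalIntegral.integral_mono_on hab hKζ.neg hKi fun x hx => ?_
    have := mul_le_mul_of_nonneg_left (neg_le_of_abs_le (hζ x hx)) (midpointKernel_nonneg a b x)
    linarith
  rw [intervalIntegral.integral_neg] at hlo
  rw [intervalIntegral.integral_const_mul, integral_midpointKernel hab] at hup hlo
  rw [abs_le]
  constructor <;> linarith


/-! ### The compound midpoint rule (2.1.3), its error bound (2.1.12) and bracketing -/

/-- The compound MIDPOINT RULE `M_n(f) = h Σ_{k<n} f(a + (k + ½) h)`, `h = (b - a)/n`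
(Davis–Rabinowitz (2.1.3); Marsden–Weinstein's Riemann sums evaluated at midpoints).
[cite: DavisRabinowitz1984, Sect. 2.1 (2.1.3)] -/
def midpointRule (f : ℝ → ℝ) (n : ℕ) (a b : ℝ) : ℝ :=
  ∑ k ∈ range n, (b - a) / n * f (a + (k + 2⁻¹) * ((b - a) / n))

/-- One panel: `M_1(f) = (b - a) f((a + b)/2)`. [cite: DavisRabinowitz1984, Sect. 2.1 (2.1.3)] -/
theorem midpointRule_one (f : ℝ → ℝ) (a b : ℝ) : midpointRule f 1 a b = (b - a) * f ((a + b) / 2) := by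
  simp only [midpointRule, sum_range_one, Nat.cast_one, div_one, Nat.cast_zero, zero_add]
  rw [show a + 2⁻¹ * (b - a) = (a + b) / 2 by ring]

/-- `M_n` is the sum of the one-panel rules over the `n` panels `[a + k h, a + (k + 1) h]` (the midpoint analogue
of Mathlib's `sum_trapezoidal_integral_adjacent_intervals`; compound rules, Sect. 2.4).
[cite: DavisRabinowitz1984, Sect. 2.1 (2.1.3)] [cite: DavisRabinowitz1984, Sect. 2.4 (2.4.1)] -/
theorem sum_midpointRule_one (f : ℝ → ℝ) (n : ℕ) (a h : ℝ) :
    ∑ k ∈ range n, midpointRule f 1 (a + k * h) (a + (k + 1) * h) = midpointRule f n a (a + n * h) := by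
  rcases Nat.eq_zero_or_pos n with rfl | hn
  · simp [midpointRule]
  · have hn' : (n : ℝ) ≠ 0 := by exact_mod_cast hn.ne'
    simp only [midpointRule_one]
    unfold midpointRule
    rw [show (a + n * h - a) / n = h by field_simp; ring]
    refine sum_congr rfl fun k _ => ?_
    rw [show a + (k + 1) * h - (a + k * h) = h by ring,
      show (a + k * h + (a + (k + 1) * h)) / 2 = a + (k + 2⁻¹) * h by ring]

/-- **Error bound for the compound midpoint rule** (Davis–Rabinowitz (2.1.12)): for `a ≤ b`, `0 < n`, `f` with
derivatives `f'`, `f''` on `[a, b]` and `|f''| ≤ ζ` there, `|∫_a^b f - M_n(f)| ≤ ζ (b - a)³ / (24 n²)`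
(half of Mathlib's trapezoidal bound `trapezoidal_error_le`). [cite: DavisRabinowitz1984, Sect. 2.1 (2.1.12)]
[cite: MarsdenWeinstein1985, Sect. 11.5 p. 552] -/
theorem abs_integral_sub_midpointRule_le {f f' f'' : ℝ → ℝ} {a b : ℝ} (hab : a ≤ b) {n : ℕ} (hn : 0 < n)
    (hf : ∀ x ∈ Icc a b, HasDerivAt f (f' x) x) (hf' : ∀ x ∈ Icc a b, HasDerivAt f' (f'' x) x)
    (hf'' : IntervalIntegrable f'' volume a b) {ζ : ℝ} (hζ : ∀ x ∈ Icc a b, |f'' x| ≤ ζ) :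
    |(∫ x in a..b, f x) - midpointRule f n a b| ≤ ζ * (b - a) ^ 3 / (24 * n ^ 2) := by
  have hn' : (0 : ℝ) < n := by exact_mod_cast hn
  set h : ℝ := (b - a) / n with hh
  have hh0 : 0 ≤ h := div_nonneg (sub_nonneg.2 hab) hn'.le
  have hb : a + n * h = b := by rw [hh]; field_simp; ring
  have hIab : [[a, b]] = Icc a b := uIcc_of_le hab
  -- the panels `[a + k h, a + (k + 1) h]`, `k < n`, lie in `[a, b]`
  have hlohi : ∀ k : ℕ, a + k * h ≤ a + (k + 1) * h := fun k => by nlinarith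
  have hsub : ∀ k < n, Icc (a + k * h) (a + (k + 1) * h) ⊆ Icc a b := by
    intro k hk
    have hk' : (k : ℝ) + 1 ≤ n := by exact_mod_cast hk
    refine Icc_subset_Icc (by nlinarith [(k.cast_nonneg : (0 : ℝ) ≤ k)]) ?_
    rw [← hb]
    nlinarith
  have hsub' : ∀ k < n, [[a + k * h, a + (k + 1) * h]] ⊆ [[a, b]] := fun k hk => by
    rw [uIcc_of_le (hlohi k), hIab]; exact hsub k hk
  -- per-panel bound
  have hpanel : ∀ k ∈ range n, |(∫ t in (a + k * h)..(a + (k + 1) * h), f t) - h * f (a + (k + 2⁻¹) * h)|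
      ≤ ζ * h ^ 3 / 24 := by
    intro k hk
    rw [Finset.mem_range] at hk
    have hp := abs_integral_sub_midpoint_le (hlohi k) (fun t ht => hf t (hsub k hk ht))
      (fun t ht => hf' t (hsub k hk ht)) (hf''.mono_set (hsub' k hk)) (fun t ht => hζ t (hsub k hk ht))
    rwa [show a + (k + 1) * h - (a + k * h) = h by ring,
      show (a + k * h + (a + (k + 1) * h)) / 2 = a + (k + 2⁻¹) * h by ring] at hp
  -- `∫ f` and `M_n(f)` as sums over the panels
  have hfi : IntervalIntegrable f volume a b :=
    ContinuousOn.intervalIntegrable fun x hx => (hf x (hIab ▸ hx)).continuousAt.continuousWithinAt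
  have hint : ∫ t in a..b, f t = ∑ k ∈ range n, ∫ t in (a + k * h)..(a + (k + 1) * h), f t := by
    have hs := intervalIntegral.sum_integral_adjacent_intervals (a := fun k : ℕ => a + k * h) (n := n)
      (μ := volume) (f := f) fun k hk => by simpa using hfi.mono_set (hsub' k hk)
    simpa [hb] using hs.symm
  have hM : midpointRule f n a b = ∑ k ∈ range n, h * f (a + (k + 2⁻¹) * h) := by
    simp only [midpointRule, ← hh]
  calc |(∫ x in a..b, f x) - midpointRule f n a b|
      = |∑ k ∈ range n, ((∫ t in (a + k * h)..(a + (k + 1) * h), f t) - h * f (a + (k + 2⁻¹) * h))| := by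
        rw [hint, hM, sum_sub_distrib]
    _ ≤ ∑ k ∈ range n, |(∫ t in (a + k * h)..(a + (k + 1) * h), f t) - h * f (a + (k + 2⁻¹) * h)| :=
        abs_sum_le_sum_abs _ _
    _ ≤ ∑ k ∈ range n, ζ * h ^ 3 / 24 := sum_le_sum hpanel
    _ = ζ * (b - a) ^ 3 / (24 * n ^ 2) := by
        rw [sum_const, card_range, nsmul_eq_mul, hh]
        field_simp

/-- **Bracketing, lower half** (Davis–Rabinowitz, Corollary after (2.1.12), p. 52): if `f'' ≥ 0` on `[a, b]`
(`a ≤ b`, `0 < n`) then `M_n(f) ≤ ∫_a^b f`. [cite: DavisRabinowitz1984, Sect. 2.1 Corollary p. 52] -/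
theorem midpointRule_le_integral {f f' f'' : ℝ → ℝ} {a b : ℝ} (hab : a ≤ b) {n : ℕ} (hn : 0 < n)
    (hf : ∀ x ∈ Icc a b, HasDerivAt f (f' x) x) (hf' : ∀ x ∈ Icc a b, HasDerivAt f' (f'' x) x)
    (hf'' : IntervalIntegrable f'' volume a b) (hpos : ∀ x ∈ Icc a b, 0 ≤ f'' x) :
    midpointRule f n a b ≤ ∫ x in a..b, f x := by
  have hn' : (0 : ℝ) < n := by exact_mod_cast hn
  set h : ℝ := (b - a) / n with hh
  have hb : a + n * h = b := by rw [hh]; field_simp; ring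
  have hIab : [[a, b]] = Icc a b := uIcc_of_le hab
  have hlohi : ∀ k : ℕ, a + k * h ≤ a + (k + 1) * h := fun k => by
    have : 0 ≤ h := div_nonneg (sub_nonneg.2 hab) hn'.le
    nlinarith
  have hsub : ∀ k < n, Icc (a + k * h) (a + (k + 1) * h) ⊆ Icc a b := by
    intro k hk
    have hk' : (k : ℝ) + 1 ≤ n := by exact_mod_cast hk
    have : 0 ≤ h := div_nonneg (sub_nonneg.2 hab) hn'.le
    refine Icc_subset_Icc (by nlinarith [(k.cast_nonneg : (0 : ℝ) ≤ k)]) ?_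
    rw [← hb]
    nlinarith
  have hsub' : ∀ k < n, [[a + k * h, a + (k + 1) * h]] ⊆ [[a, b]] := fun k hk => by
    rw [uIcc_of_le (hlohi k), hIab]; exact hsub k hk
  -- per panel `∫ f - h f(mid) = ∫ K_M f'' ≥ 0`
  have hpanel : ∀ k ∈ range n, h * f (a + (k + 2⁻¹) * h) ≤ ∫ t in (a + k * h)..(a + (k + 1) * h), f t := by
    intro k hk
    rw [Finset.mem_range] at hk
    have hp := integral_sub_midpoint_eq_integral_kernel (hlohi k) (fun t ht => hf t (hsub k hk ht))
      (fun t ht => hf' t (hsub k hk ht)) (hf''.mono_set (hsub' k hk))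
    rw [show a + (k + 1) * h - (a + k * h) = h by ring,
      show (a + k * h + (a + (k + 1) * h)) / 2 = a + (k + 2⁻¹) * h by ring] at hp
    have hK : 0 ≤ ∫ t in (a + k * h)..(a + (k + 1) * h), midpointKernel (a + k * h) (a + (k + 1) * h) t * f'' t :=
      intervalIntegral.integral_nonneg (hlohi k) fun t ht =>
        mul_nonneg (midpointKernel_nonneg _ _ t) (hpos t (hsub k hk ht))
    linarith
  have hfi : IntervalIntegrable f volume a b :=
    ContinuousOn.intervalIntegrable fun x hx => (hf x (hIab ▸ hx)).continuousAt.continuousWithinAt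
  have hint : ∫ t in a..b, f t = ∑ k ∈ range n, ∫ t in (a + k * h)..(a + (k + 1) * h), f t := by
    have hs := intervalIntegral.sum_integral_adjacent_intervals (a := fun k : ℕ => a + k * h) (n := n)
      (μ := volume) (f := f) fun k hk => by simpa using hfi.mono_set (hsub' k hk)
    simpa [hb] using hs.symm
  have hM : midpointRule f n a b = ∑ k ∈ range n, h * f (a + (k + 2⁻¹) * h) := by
    simp only [midpointRule, ← hh]
  rw [hint, hM]
  exact sum_le_sum hpanel

/-- **Bracketing, upper half** (loc. cit.): if `f'' ≥ 0` on `[a, b]` (`a ≤ b`, `0 < n`) then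
`∫_a^b f ≤ T_n(f)` for Mathlib's compound trapezoidal rule `trapezoidal_integral f n a b`; together with
`midpointRule_le_integral`, `M_n(f) ≤ ∫ f ≤ T_n(f)`: a two-sided enclosure of the integral of a convex function
from function values alone. [cite: DavisRabinowitz1984, Sect. 2.1 Corollary p. 52] -/
theorem integral_le_trapezoidal_integral {f f' f'' : ℝ → ℝ} {a b : ℝ} (hab : a ≤ b) {n : ℕ} (hn : 0 < n)
    (hf : ∀ x ∈ Icc a b, HasDerivAt f (f' x) x) (hf' : ∀ x ∈ Icc a b, HasDerivAt f' (f'' x) x)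
    (hf'' : IntervalIntegrable f'' volume a b) (hpos : ∀ x ∈ Icc a b, 0 ≤ f'' x) :
    ∫ x in a..b, f x ≤ trapezoidal_integral f n a b := by
  have hn' : (0 : ℝ) < n := by exact_mod_cast hn
  set h : ℝ := (b - a) / n with hh
  have hb : a + n * h = b := by rw [hh]; field_simp; ring
  have hIab : [[a, b]] = Icc a b := uIcc_of_le hab
  have hlohi : ∀ k : ℕ, a + k * h ≤ a + (k + 1) * h := fun k => by
    have : 0 ≤ h := div_nonneg (sub_nonneg.2 hab) hn'.le
    nlinarith
  have hsub : ∀ k < n, Icc (a + k * h) (a + (k + 1) * h) ⊆ Icc a b := by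
    intro k hk
    have hk' : (k : ℝ) + 1 ≤ n := by exact_mod_cast hk
    have : 0 ≤ h := div_nonneg (sub_nonneg.2 hab) hn'.le
    refine Icc_subset_Icc (by nlinarith [(k.cast_nonneg : (0 : ℝ) ≤ k)]) ?_
    rw [← hb]
    nlinarith
  have hsub' : ∀ k < n, [[a + k * h, a + (k + 1) * h]] ⊆ [[a, b]] := fun k hk => by
    rw [uIcc_of_le (hlohi k), hIab]; exact hsub k hk
  -- per panel `T_1 - ∫ f = ½ ∫ (t - lo)(hi - t) f'' ≥ 0`
  have hpanel : ∀ k ∈ range n, ∫ t in (a + k * h)..(a + (k + 1) * h), f t ≤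
      trapezoidal_integral f 1 (a + k * h) (a + (k + 1) * h) := by
    intro k hk
    rw [Finset.mem_range] at hk
    have hI : [[a + k * h, a + (k + 1) * h]] = Icc (a + k * h) (a + (k + 1) * h) := uIcc_of_le (hlohi k)
    have hp := trapezoidal_error_one_eq_integral_kernel (a := a + k * h) (b := a + (k + 1) * h) (f := f)
      (fun t ht => hf t (hsub k hk (hI ▸ ht))) (fun t ht => hf' t (hsub k hk (hI ▸ ht))) (hf''.mono_set (hsub' k hk))
    have hK : 0 ≤ ∫ t in (a + k * h)..(a + (k + 1) * h), (t - (a + k * h)) * (a + (k + 1) * h - t) * f'' t :=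
      intervalIntegral.integral_nonneg (hlohi k) fun t ht =>
        mul_nonneg (mul_nonneg (sub_nonneg.2 ht.1) (sub_nonneg.2 ht.2)) (hpos t (hsub k hk ht))
    rw [trapezoidal_error] at hp
    linarith
  have hfi : IntervalIntegrable f volume a b :=
    ContinuousOn.intervalIntegrable fun x hx => (hf x (hIab ▸ hx)).continuousAt.continuousWithinAt
  have hint : ∫ t in a..b, f t = ∑ k ∈ range n, ∫ t in (a + k * h)..(a + (k + 1) * h), f t := by
    have hs := intervalIntegral.sum_integral_adjacent_intervals (a := fun k : ℕ => a + k * h) (n := n)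
      (μ := volume) (f := f) fun k hk => by simpa using hfi.mono_set (hsub' k hk)
    simpa [hb] using hs.symm
  have hT : trapezoidal_integral f n a b = ∑ k ∈ range n, trapezoidal_integral f 1 (a + k * h) (a + (k + 1) * h) := by
    rw [sum_trapezoidal_integral_adjacent_intervals hn, hb]
  rw [hint, hT]
  exact sum_le_sum hpanel

end

end Literature.Analysis.Quadrature
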